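import Summits.QuantumFields.YangMills.Theorems.BalabanUVNodesN07AliasSumPositivityCore
import HarnessLib

/-!
# DAG node N07 (road R0′ at the record; the `hker` ∕ `hpos` letter) — ANALYTIC CORE OF THE POINT-FEASIBILITY LEMMA (P),
# part 2: the sine data and «`K(θ) > 0`»

Width seat `pub-ymgap-dag-n07-w7` (g2), `--supports stmt-QuantumFields-20542 --as helper`; count-neutral; 0 `def`.

Part 1 (`…N07AliasSumPositivityCore`, p613440) proved, integral-free, `aliasCore_pos`: for any finite non-empty `J`, odd
`L`, positive HILL-SHAPED data `s κ : ℕ → ℝ` and any `F` in every class `iterMono k`,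
`0 < Σ_{m : J → Fin L} (Π_κ (−1)^{m κ} ∕ s κ (m κ)) · F (Σ_κ (s κ (m κ))²)`.  THIS FILE supplies the sine data of the
aliased centre-sampling symbol of the lane note LOCATED-POINT-FEASIBILITY (dag-n07-e g20, steps 2–4) and concludes:
* §5 `aliasAngle_mem` (the alias angles `(ϑ + 2πm)∕(2L)`, `m < L`, lie in `(0,π)` for `ϑ ∈ (0,2π)`), `sineAlias_pos`,
  ★ `sineAlias_hill` (`m ↦ sin((ϑ+2πm)∕(2L))` is non-decreasing on `[0,p]` and non-increasing on `[p+1,L−1]` with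
  `p = ⌊(πL − ϑ)∕(2π)⌋₊` — `Real.sin` monotone on `[−π∕2, π∕2]`, `sin x = sin (π − x)`);
* §6 ★★★ `aliasSum_pos`: for block momenta `θ_κ ∈ (0,2π)` (`κ : J`, finite non-empty) and odd `L`,
  `0 < Σ_{m : J → Fin L} (Π_κ (−1)^{m κ} ∕ sin((θ_κ + 2π m κ)∕(2L))) ∕ (Σ_κ sin((θ_κ + 2π m κ)∕(2L))²)²`
  (= `aliasCore_pos` with `F = x⁻¹·x⁻¹`), and ★★★ `aliasSymbolK_pos`: the display
  `0 < L^{−|J|} Σ_m Π_κ [(−1)^{m κ} sin(θ_κ∕2) ∕ s_{m κ}(θ_κ)] · (4 Σ_κ s_{m κ}(θ_κ)²)^{−2}` — «`K(θ) > 0`» of step 2 with the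
  coordinates `θ_κ ∉ 2πℤ` collected in `J` (a coordinate with `θ_κ = 0` contributes the positive factor `L` and is omitted).

HONEST SCOPE.  Elementary trigonometry + part 1; nothing of [B11]∕[B6]∕[3] asserted; the block-Fourier reduction of (P) to
`K(θ) ≠ 0` (steps 1–2: sectors, the aliasing identity, Δ's spectrum) and the multi-level (P)_D are NOT here (lane owner's
(t3) ∕ open); `hker`, stub 1, K0⁷∕K1⁷ NOT closed; N07 not discharged; nothing continuum ∕ OS ∕ mass gap.
Context: T. Bałaban, CMP **96** (1984) 223–250 [Balaban1984PropagatorsII] (2.22) p.226; [Balaban1987RG1] (0.4) (centres of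
blocks ⇒ odd `L`) — nothing is cited as a hypothesis.
-/

set_option autoImplicit false

noncomputable section

open Finset

namespace Summit.QuantumFields.YangMills.Theorems.N07AliasSumPositivity

/-! ## §5  The sine data of the aliased symbol -/

section Sine

open Real

/-- The alias angles `α_m = (ϑ + 2πm)∕(2L)`, `m < L`, lie in `(0, π)` for `ϑ ∈ (0, 2π)`. [folklore] -/
theorem aliasAngle_mem {ϑ : ℝ} (h0 : 0 < ϑ) (h1 : ϑ < 2 * π) {L m : ℕ} (hm : m < L) :
    0 < (ϑ + 2 * π * m) / (2 * L) ∧ (ϑ + 2 * π * m) / (2 * L) < π := by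
  have hL : (1 : ℝ) ≤ L := by exact_mod_cast (show 1 ≤ L by omega)
  have hm' : (m : ℝ) ≤ L - 1 := by
    have : m + 1 ≤ L := hm
    have : ((m + 1 : ℕ) : ℝ) ≤ L := by exact_mod_cast this
    push_cast at this; linarith
  have h2L : (0 : ℝ) < 2 * L := by positivity
  refine ⟨by positivity, (div_lt_iff₀ h2L).mpr ?_⟩
  nlinarith [pi_pos]

/-- `s_m(ϑ) = sin((ϑ + 2πm)∕(2L)) > 0` for `ϑ ∈ (0,2π)`, `m < L`. [folklore] -/
theorem sineAlias_pos {ϑ : ℝ} (h0 : 0 < ϑ) (h1 : ϑ < 2 * π) {L m : ℕ} (hm : m < L) :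
    0 < sin ((ϑ + 2 * π * m) / (2 * L)) :=
  let h := aliasAngle_mem h0 h1 hm
  sin_pos_of_pos_of_lt_pi h.1 h.2

/-- ★ **The sine data are HILL-SHAPED**: with `q := (πL − ϑ)∕(2π)` and `p := ⌊q⌋₊`, `m ↦ sin((ϑ + 2πm)∕(2L))` is
non-decreasing on `[0, p]` (angles `≤ π∕2`) and non-increasing on `[p+1, L−1]` (angles in `[π∕2, π)`). [folklore] -/
theorem sineAlias_hill {ϑ : ℝ} (h0 : 0 < ϑ) (h1 : ϑ < 2 * π) (L : ℕ) :
    ∃ p : ℕ, (∀ m m' : ℕ, m ≤ m' → m' ≤ p → m' < L →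
        sin ((ϑ + 2 * π * m) / (2 * L)) ≤ sin ((ϑ + 2 * π * m') / (2 * L))) ∧
      (∀ m m' : ℕ, p + 1 ≤ m → m ≤ m' → m' < L →
        sin ((ϑ + 2 * π * m') / (2 * L)) ≤ sin ((ϑ + 2 * π * m) / (2 * L))) := by
  set q : ℝ := (π * L - ϑ) / (2 * π) with hq
  have h2πq : 2 * π * q = π * L - ϑ := by
    rw [hq]; field_simp
  refine ⟨⌊q⌋₊, ?_, ?_⟩
  · intro m m' hmm' hm'p hm'L
    rcases Nat.eq_or_lt_of_le hmm' with h | h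
    · rw [h]
    have h2L : (0 : ℝ) < 2 * L := by
      have : (1 : ℝ) ≤ L := by exact_mod_cast (show 1 ≤ L by omega)
      positivity
    have hq1 : 1 ≤ q := (Nat.one_le_floor_iff q).mp (by omega)
    have hm'q : (m' : ℝ) ≤ q := le_trans (by exact_mod_cast hm'p) (Nat.floor_le (by linarith))
    refine sin_le_sin_of_le_of_le_pi_div_two ?_ ?_ ?_
    · have := (aliasAngle_mem h0 h1 (h.trans hm'L)).1
      linarith [pi_pos]
    · rw [div_le_iff₀ h2L]
      nlinarith [pi_pos]
    · exact div_le_div_of_nonneg_right (by have : (m : ℝ) ≤ m' := (by exact_mod_cast hmm'); nlinarith [pi_pos])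
        h2L.le
  · intro m m' hpm hmm' hm'L
    have h2L : (0 : ℝ) < 2 * L := by
      have : (1 : ℝ) ≤ L := by exact_mod_cast (show 1 ≤ L by omega)
      positivity
    have hqm : q < m := lt_of_lt_of_le (Nat.lt_floor_add_one q) (by exact_mod_cast hpm)
    have hαm : π / 2 < (ϑ + 2 * π * m) / (2 * L) := by
      rw [lt_div_iff₀ h2L]; nlinarith [pi_pos]
    have hαm' : (ϑ + 2 * π * m') / (2 * L) < π := (aliasAngle_mem h0 h1 hm'L).2
    have hle : (ϑ + 2 * π * m) / (2 * L) ≤ (ϑ + 2 * π * m') / (2 * L) :=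
      div_le_div_of_nonneg_right (by have : (m : ℝ) ≤ m' := (by exact_mod_cast hmm'); nlinarith [pi_pos]) h2L.le
    rw [← sin_pi_sub ((ϑ + 2 * π * m') / (2 * L)), ← sin_pi_sub ((ϑ + 2 * π * m) / (2 * L))]
    exact sin_le_sin_of_le_of_le_pi_div_two (by linarith) (by linarith) (by linarith)

end Sine

/-! ## §6  «K(θ) > 0» -/

/-- ★★★ **Positivity of the aliased centre-sampling symbol** (LOCATED-POINT-FEASIBILITY, step 2's display up to its
positive prefactor `L^{−|J|}·Π_κ sin(θ_κ∕2)·4^{−2}`): for a finite non-empty set `J` of coordinates, block momenta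
`θ_κ ∈ (0, 2π)` and ODD block side `L`,
`0 < Σ_{m : J → Fin L} (Π_κ (−1)^{m κ} ∕ sin((θ_κ + 2π m κ)∕(2L))) ∕ (Σ_κ sin((θ_κ + 2π m κ)∕(2L))²)²`.
[folklore] -/
theorem aliasSum_pos {J : Type*} [Fintype J] [DecidableEq J] [Nonempty J] {L : ℕ} (hL : Odd L) (θ : J → ℝ)
    (hθ : ∀ κ, 0 < θ κ ∧ θ κ < 2 * Real.pi) :
    0 < ∑ m : J → Fin L, (∏ κ, (-1 : ℝ) ^ (m κ : ℕ) / Real.sin ((θ κ + 2 * Real.pi * (m κ : ℕ)) / (2 * L))) /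
      (∑ κ, Real.sin ((θ κ + 2 * Real.pi * (m κ : ℕ)) / (2 * L)) ^ 2) ^ 2 := by
  have h := aliasCore_pos hL (fun κ (m : ℕ) => Real.sin ((θ κ + 2 * Real.pi * m) / (2 * L)))
    (fun κ m hm => sineAlias_pos (hθ κ).1 (hθ κ).2 hm) (fun κ => sineAlias_hill (hθ κ).1 (hθ κ).2 L)
    (fun x => x⁻¹ * x⁻¹) iterMono_inv_mul_inv
  refine lt_of_lt_of_eq h (Fintype.sum_congr _ _ (fun m => ?_))
  simp only [div_eq_mul_inv, sq, mul_inv]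

/-- ★★★ **«`K(θ) > 0`» in the display of LOCATED-POINT-FEASIBILITY step 2** (all coordinates with `θ_κ ∉ 2πℤ`
collected in `J`; coordinates with `θ_κ = 0` contribute the positive factor `L` each and are omitted):
`0 < L^{−|J|} Σ_m Π_κ [(−1)^{m κ} sin(θ_κ∕2) ∕ s_{m κ}(θ_κ)] · (4 Σ_κ s_{m κ}(θ_κ)²)^{−2}`. [folklore] -/
theorem aliasSymbolK_pos {J : Type*} [Fintype J] [DecidableEq J] [Nonempty J] {L : ℕ} (hL : Odd L) (θ : J → ℝ)
    (hθ : ∀ κ, 0 < θ κ ∧ θ κ < 2 * Real.pi) :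
    0 < ((L : ℝ) ^ Fintype.card J)⁻¹ * ∑ m : J → Fin L,
      (∏ κ, (-1 : ℝ) ^ (m κ : ℕ) * Real.sin (θ κ / 2) / Real.sin ((θ κ + 2 * Real.pi * (m κ : ℕ)) / (2 * L))) /
        (4 * ∑ κ, Real.sin ((θ κ + 2 * Real.pi * (m κ : ℕ)) / (2 * L)) ^ 2) ^ 2 := by
  have hLpos : (0 : ℝ) < L := by
    obtain ⟨r, hr⟩ := hL
    exact_mod_cast (show 0 < L by omega)
  have hsin : 0 < ∏ κ : J, Real.sin (θ κ / 2) := by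
    refine Finset.prod_pos (fun κ _ => Real.sin_pos_of_pos_of_lt_pi (by linarith [(hθ κ).1]) ?_)
    linarith [(hθ κ).2]
  have key : ∀ m : J → Fin L,
      (∏ κ, (-1 : ℝ) ^ (m κ : ℕ) * Real.sin (θ κ / 2) / Real.sin ((θ κ + 2 * Real.pi * (m κ : ℕ)) / (2 * L))) /
        (4 * ∑ κ, Real.sin ((θ κ + 2 * Real.pi * (m κ : ℕ)) / (2 * L)) ^ 2) ^ 2 =
      ((∏ κ : J, Real.sin (θ κ / 2)) / 16) *
        ((∏ κ, (-1 : ℝ) ^ (m κ : ℕ) / Real.sin ((θ κ + 2 * Real.pi * (m κ : ℕ)) / (2 * L))) /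
          (∑ κ, Real.sin ((θ κ + 2 * Real.pi * (m κ : ℕ)) / (2 * L)) ^ 2) ^ 2) := by
    intro m
    have e : (∏ κ, (-1 : ℝ) ^ (m κ : ℕ) * Real.sin (θ κ / 2) / Real.sin ((θ κ + 2 * Real.pi * (m κ : ℕ)) / (2 * L)))
        = (∏ κ : J, Real.sin (θ κ / 2)) *
          ∏ κ, (-1 : ℝ) ^ (m κ : ℕ) / Real.sin ((θ κ + 2 * Real.pi * (m κ : ℕ)) / (2 * L)) := by
      rw [← Finset.prod_mul_distrib]
      exact Finset.prod_congr rfl (fun κ _ => by ring)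
    rw [e]
    ring
  simp only [key, ← Finset.mul_sum]
  exact mul_pos (by positivity) (mul_pos (by positivity) (aliasSum_pos hL θ hθ))

end Summit.QuantumFields.YangMills.Theorems.N07AliasSumPositivity

end
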